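import Mathlib
import HarnessLib
import Summits.ValiantsHypothesis.ValiantsHypothesis.Theorems.EquivariantDialLeVerrierABP

/-!
# Equivariant-dc dial: the INTERTWINING IDENTITIES of Le Verrier's program — conjugating the inner block
# `Z ↦ M Z M⁻¹` and rescaling the border is undone layer by layer by `M⁻ᵀ ⊗ M` on `n × n`, `β M⁻ᵀ` on `n` and
# characters on `⋆` (decomp-valiant workshop, lens 1, generation 16) — support file of census cell A; NOT a route

HONEST FRAMING.  `VP ≠ VNP` is NOT proved here and nothing in this file is progress on it.  Sorry-free SUPPORT
file of the census cell `A = EquivariantDialNode.EqHardBiPerm` (item `stmt-ValiantsHypothesis-23702`): the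
ALGEBRA of the lifts of Le Verrier's program (`EquivariantDialLeVerrierABP.BlockGauge.program`), i.e. of
arrow 2 of Theorem H (`EquivariantDialGrading.GradingCost`).  Kernel-checked, no `sorry`, no axioms, over an
arbitrary commutative ring `R` (in the application `R = k[x]` and `Mc = M`, `Mi = M⁻¹` are constant):
* §1 the three layer matrices of the program as functions of the RAW data (`stepRaw Z κ`, `collectRaw Z c κ`,
  `sinkRaw r ℓ`; `rfl`-bridges `BlockGauge.stepBlk_eq_raw` …), the structure formula
  `stepRaw Z κ = −(Zᵀ ⊗ 1) + (vec Zᵀ) ⊗ (κ δ)` (`stepRaw_eq`), and their images under a ring map fixing `κ`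
  (`stepRaw_map`, `collectRaw_map`, `sinkRaw_map`);
* §2 the INTERTWINING IDENTITIES (all inverse-free; hypotheses `Mi * Mc = 1`, `αi * αc = 1`, `βi * βc = 1`):
  `(Miᵀ ⊗ Mc) · step(Z) = step(Mc Z Mi) · (Miᵀ ⊗ Mc)` (`kron_mul_stepRaw`, via `Matrix.mul_kronecker_mul` and
  the rank-one calculus `Matrix.mul_vecMulVec` / `Matrix.vecMulVec_mul`);
  `(Miᵀ ⊗ Mc) · collect(Z, c) = collect(Mc Z Mi, βi Mc c) · diag(βc Miᵀ, 1)` (`kron_mul_collectRaw`);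
  `diag(βc Miᵀ, 1) · sink(r, ℓ) = sink(αc r Mi, αc βi ℓ) · diag(βc Miᵀ, αi βc)` (`blocks_mul_sinkRaw`);
  and the source identity `δ ᵥ* (Miᵀ ⊗ Mc) = δ` (`delta_vecMul_kron`).
These are exactly the layer equations `R_t · T_t = T_t(γ·x) · R_{t+1}` of an exact layerwise lift of the program
under block-gauge lift data `Z(γx) = M Z M⁻¹`, `c(γx) = β⁻¹ M c`, `r(γx) = α r M⁻¹`, `ℓ(γx) = αβ⁻¹ ℓ`; the `GL`
packaging is the next file.  Census reading: no new cell, no tag change.  No `instance`, no `notation`.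
-/

set_option linter.dupNamespace false

namespace Summit.ValiantsHypothesis.ValiantsHypothesis.Theorems.EquivariantDialLayers

open MvPolynomial Matrix
open scoped Kronecker

noncomputable section

/-! ## §1 The layer matrices as functions of the raw data -/

section Raw

variable {R : Type*} [CommRing R] {n : Type*} [Fintype n] [DecidableEq n]

/-- Le Verrier step with constant `κ`: `N ↦ κ tr(Z N) · 1 − Z N` (row-vector convention). -/
def stepRaw (Z : Matrix n n R) (κ : R) : Matrix (n × n) (n × n) R := fun a b =>
  (if a.2 = b.2 then -Z b.1 a.1 else 0) + (if b.1 = b.2 then κ * Z a.2 a.1 else 0)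

/-- Collecting layer: `N ↦ (N c, κ tr(Z N))`. -/
def collectRaw (Z : Matrix n n R) (c : n → R) (κ : R) : Matrix (n × n) (n ⊕ Unit) R := fun a q =>
  Sum.elim (fun i => if a.1 = i then c a.2 else 0) (fun _ => κ * Z a.2 a.1) q

/-- Closing layer: `(x, E) ↦ (0, −Σ xᵢ rᵢ + E ℓ)`. -/
def sinkRaw (r : n → R) (ℓ : R) : Matrix (n ⊕ Unit) (n ⊕ Unit) R := fun q q' =>
  Sum.elim (fun _ => 0) (fun _ => Sum.elim (fun i => -r i) (fun _ => ℓ) q) q'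

omit [Fintype n] in
/-- STRUCTURE FORMULA: `step = −(Zᵀ ⊗ 1) + (vec Zᵀ) (κ δ)ᵀ`, a Kronecker product plus a rank-one matrix. -/
theorem stepRaw_eq (Z : Matrix n n R) (κ : R) :
    stepRaw Z κ = -(Zᵀ ⊗ₖ (1 : Matrix n n R)) +
      vecMulVec (fun a : n × n => Z a.2 a.1) (fun b : n × n => if b.1 = b.2 then κ else 0) := by
  ext ⟨a1, a2⟩ ⟨b1, b2⟩
  simp only [stepRaw, Matrix.add_apply, Matrix.neg_apply, kronecker_apply, transpose_apply, Matrix.one_apply,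
    vecMulVec_apply, mul_ite, mul_one, mul_zero]
  split_ifs <;> ring

omit [Fintype n] in
/-- Image of the step under a ring map fixing `κ`. -/
theorem stepRaw_map {S : Type*} [CommRing S] (f : R →+* S) (Z : Matrix n n R) (κ : R) :
    (stepRaw Z κ).map f = stepRaw (Z.map f) (f κ) := by
  ext a b
  simp [stepRaw, apply_ite f]

omit [Fintype n] in
/-- Image of the collecting layer under a ring map. -/
theorem collectRaw_map {S : Type*} [CommRing S] (f : R →+* S) (Z : Matrix n n R) (c : n → R) (κ : R) :
    (collectRaw Z c κ).map f = collectRaw (Z.map f) (fun i => f (c i)) (f κ) := by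
  ext a q
  rcases q with i | u <;> simp [collectRaw, apply_ite f]

omit [Fintype n] [DecidableEq n] in
/-- Image of the closing layer under a ring map. -/
theorem sinkRaw_map {S : Type*} [CommRing S] (f : R →+* S) (r : n → R) (ℓ : R) :
    (sinkRaw r ℓ).map f = sinkRaw (fun i => f (r i)) (f ℓ) := by
  ext q q'
  rcases q with i | u <;> rcases q' with j | u' <;> simp [sinkRaw]

/-! ## §2 The intertwining identities -/

/-- SOURCE: the identity matrix `δ` (as a row vector on `n × n`) is fixed by `Miᵀ ⊗ Mc` up to nothing:
`(κδ) ᵥ* (Miᵀ ⊗ Mc) = κ δ` whenever `Mi Mc = 1`. -/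
theorem delta_vecMul_kron (Mc Mi : Matrix n n R) (hMi : Mi * Mc = 1) (κ : R) :
    (fun b : n × n => if b.1 = b.2 then κ else 0) ᵥ* (Miᵀ ⊗ₖ Mc) = fun b => if b.1 = b.2 then κ else 0 := by
  funext ⟨b1, b2⟩
  have h : ∑ a1 : n, κ * (Mi b1 a1 * Mc a1 b2) = κ * (Mi * Mc) b1 b2 := by
    rw [Matrix.mul_apply, Finset.mul_sum]
  simp only [Matrix.vecMul, dotProduct, Fintype.sum_prod_type, kronecker_apply, transpose_apply, ite_mul,
    zero_mul, Finset.sum_ite_eq, Finset.mem_univ, if_true, h, hMi, Matrix.one_apply, mul_ite, mul_one,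
    mul_zero]

omit [DecidableEq n] in
/-- The conjugated inner block, as a vector on `n × n`: `(Miᵀ ⊗ Mc) (vec Zᵀ) = vec (Mc Z Mi)ᵀ`. -/
theorem kron_mulVec_vecZ (Mc Mi Z : Matrix n n R) :
    (Miᵀ ⊗ₖ Mc) *ᵥ (fun a : n × n => Z a.2 a.1) = fun a => (Mc * Z * Mi) a.2 a.1 := by
  funext ⟨a1, a2⟩
  simp only [Matrix.mulVec, dotProduct, Fintype.sum_prod_type, kronecker_apply, transpose_apply,
    Matrix.mul_apply, Finset.sum_mul]
  exact Finset.sum_congr rfl fun _ _ => Finset.sum_congr rfl fun _ _ => by ring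

/-- **STEP INTERTWINING.**  `(Miᵀ ⊗ Mc) · step(Z) = step(Mc Z Mi) · (Miᵀ ⊗ Mc)` if `Mi Mc = 1`. -/
theorem kron_mul_stepRaw (Mc Mi Z : Matrix n n R) (hMi : Mi * Mc = 1) (κ : R) :
    Miᵀ ⊗ₖ Mc * stepRaw Z κ = stepRaw (Mc * Z * Mi) κ * (Miᵀ ⊗ₖ Mc) := by
  have hT : Miᵀ * Zᵀ = (Mc * Z * Mi)ᵀ * Miᵀ := by
    rw [← transpose_mul, ← transpose_mul, ← Matrix.mul_assoc, ← Matrix.mul_assoc, hMi, Matrix.one_mul]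
  rw [stepRaw_eq, stepRaw_eq, Matrix.mul_add, Matrix.add_mul, Matrix.mul_neg, Matrix.neg_mul,
    ← mul_kronecker_mul, ← mul_kronecker_mul, Matrix.mul_one, Matrix.one_mul, hT, mul_vecMulVec,
    vecMulVec_mul, kron_mulVec_vecZ, delta_vecMul_kron Mc Mi hMi]

/-- **COLLECT INTERTWINING.**  `(Miᵀ ⊗ Mc) · collect(Z, c) = collect(Mc Z Mi, βi Mc c) · diag(βc Miᵀ, 1)`
if `βi βc = 1` (no hypothesis on `Mc`, `Mi` is needed here). -/
theorem kron_mul_collectRaw (Mc Mi Z : Matrix n n R) (c : n → R) (βc βi : R) (hβ : βi * βc = 1) (κ : R) :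
    Miᵀ ⊗ₖ Mc * collectRaw Z c κ =
      collectRaw (Mc * Z * Mi) (fun i => βi * (Mc *ᵥ c) i) κ *
        fromBlocks (βc • Miᵀ) 0 0 (1 : Matrix Unit Unit R) := by
  ext ⟨a1, a2⟩ q
  rcases q with i | u
  · have hL : (Miᵀ ⊗ₖ Mc * collectRaw Z c κ) (a1, a2) (Sum.inl i) = Mi i a1 * (Mc *ᵥ c) a2 := by
      simp only [Matrix.mul_apply, collectRaw, Sum.elim_inl, kronecker_apply, transpose_apply,
        Fintype.sum_prod_type, mul_ite, mul_zero, Finset.sum_ite_irrel, Finset.sum_const_zero,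
        Finset.sum_ite_eq', Finset.mem_univ, if_true, Matrix.mulVec, dotProduct, Finset.mul_sum]
      exact Finset.sum_congr rfl fun _ _ => by ring
    have hR : (collectRaw (Mc * Z * Mi) (fun i => βi * (Mc *ᵥ c) i) κ *
        fromBlocks (βc • Miᵀ) 0 0 (1 : Matrix Unit Unit R)) (a1, a2) (Sum.inl i) =
        βi * (Mc *ᵥ c) a2 * (βc * Mi i a1) := by
      simp only [Matrix.mul_apply, collectRaw, Fintype.sum_sum_type, Sum.elim_inl, Sum.elim_inr,
        fromBlocks_apply₁₁, fromBlocks_apply₂₁, Matrix.zero_apply, mul_zero, Finset.sum_const_zero,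
        add_zero, ite_mul, zero_mul, Finset.sum_ite_eq, Finset.mem_univ, if_true, Matrix.smul_apply,
        transpose_apply, smul_eq_mul]
    rw [hL, hR]
    linear_combination (-(Mi i a1 * (Mc *ᵥ c) a2)) * hβ
  · have hL : (Miᵀ ⊗ₖ Mc * collectRaw Z c κ) (a1, a2) (Sum.inr u) = κ * (Mc * Z * Mi) a2 a1 := by
      simp only [Matrix.mul_apply, collectRaw, Sum.elim_inr, kronecker_apply, transpose_apply,
        Fintype.sum_prod_type, Finset.mul_sum, Finset.sum_mul]
      exact Finset.sum_congr rfl fun _ _ => Finset.sum_congr rfl fun _ _ => by ring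
    have hR : (collectRaw (Mc * Z * Mi) (fun i => βi * (Mc *ᵥ c) i) κ *
        fromBlocks (βc • Miᵀ) 0 0 (1 : Matrix Unit Unit R)) (a1, a2) (Sum.inr u) =
        κ * (Mc * Z * Mi) a2 a1 := by
      simp only [Matrix.mul_apply, collectRaw, Fintype.sum_sum_type, Sum.elim_inl, Sum.elim_inr,
        fromBlocks_apply₁₂, fromBlocks_apply₂₂, Matrix.zero_apply, mul_zero, Finset.sum_const_zero,
        zero_add, Finset.univ_unique, Finset.sum_singleton, Matrix.one_apply_eq, mul_one]
    rw [hL, hR]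

omit [DecidableEq n] in
/-- **SINK INTERTWINING.**  `diag(βc Miᵀ, 1) · sink(r, ℓ) = sink(αc r Mi, αc βi ℓ) · diag(βc Miᵀ, αi βc)` if
`αi αc = 1` and `βi βc = 1`. -/
theorem blocks_mul_sinkRaw (Mi : Matrix n n R) (r : n → R) (ℓ αc αi βc βi : R) (hα : αi * αc = 1)
    (hβ : βi * βc = 1) :
    fromBlocks (βc • Miᵀ) 0 0 (1 : Matrix Unit Unit R) * sinkRaw r ℓ =
      sinkRaw (fun j => αc * (r ᵥ* Mi) j) (αc * βi * ℓ) *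
        fromBlocks (βc • Miᵀ) 0 0 ((αi * βc) • (1 : Matrix Unit Unit R)) := by
  ext q q'
  rcases q' with i | u
  · simp [Matrix.mul_apply, sinkRaw, Fintype.sum_sum_type]
  · rcases q with j | u'
    · have hL : (fromBlocks (βc • Miᵀ) 0 0 (1 : Matrix Unit Unit R) * sinkRaw r ℓ) (Sum.inl j) (Sum.inr u) =
          -(βc * (r ᵥ* Mi) j) := by
        simp only [Matrix.mul_apply, sinkRaw, Fintype.sum_sum_type, Sum.elim_inl, Sum.elim_inr,
          fromBlocks_apply₁₁, fromBlocks_apply₁₂, Matrix.zero_apply, zero_mul, Finset.sum_const_zero,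
          add_zero, Matrix.smul_apply, transpose_apply, smul_eq_mul, mul_neg, Finset.sum_neg_distrib,
          Matrix.vecMul, dotProduct, Finset.mul_sum]
        exact congrArg Neg.neg (Finset.sum_congr rfl fun _ _ => by ring)
      have hR : (sinkRaw (fun j => αc * (r ᵥ* Mi) j) (αc * βi * ℓ) *
          fromBlocks (βc • Miᵀ) 0 0 ((αi * βc) • (1 : Matrix Unit Unit R))) (Sum.inl j) (Sum.inr u) =
          -(αc * (r ᵥ* Mi) j) * (αi * βc) := by
        simp only [Matrix.mul_apply, sinkRaw, Fintype.sum_sum_type, Sum.elim_inl, Sum.elim_inr,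
          fromBlocks_apply₁₂, fromBlocks_apply₂₂, Matrix.zero_apply, mul_zero, Finset.sum_const_zero,
          zero_add, Finset.univ_unique, Finset.sum_singleton, Matrix.smul_apply, Matrix.one_apply_eq,
          smul_eq_mul, mul_one]
      rw [hL, hR]
      linear_combination (βc * (r ᵥ* Mi) j) * hα
    · have hL : (fromBlocks (βc • Miᵀ) 0 0 (1 : Matrix Unit Unit R) * sinkRaw r ℓ) (Sum.inr u') (Sum.inr u) =
          ℓ := by
        simp only [Matrix.mul_apply, sinkRaw, Fintype.sum_sum_type, Sum.elim_inl, Sum.elim_inr,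
          fromBlocks_apply₂₁, fromBlocks_apply₂₂, Matrix.zero_apply, zero_mul, Finset.sum_const_zero,
          zero_add, Finset.univ_unique, Finset.sum_singleton, Matrix.one_apply_eq, one_mul]
      have hR : (sinkRaw (fun j => αc * (r ᵥ* Mi) j) (αc * βi * ℓ) *
          fromBlocks (βc • Miᵀ) 0 0 ((αi * βc) • (1 : Matrix Unit Unit R))) (Sum.inr u') (Sum.inr u) =
          αc * βi * ℓ * (αi * βc) := by
        simp only [Matrix.mul_apply, sinkRaw, Fintype.sum_sum_type, Sum.elim_inl, Sum.elim_inr,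
          fromBlocks_apply₁₂, fromBlocks_apply₂₂, Matrix.zero_apply, mul_zero, Finset.sum_const_zero,
          zero_add, Finset.univ_unique, Finset.sum_singleton, Matrix.smul_apply, Matrix.one_apply_eq,
          smul_eq_mul, mul_one]
      rw [hL, hR]
      linear_combination (-(βi * βc * ℓ)) * hα - ℓ * hβ

end Raw

/-! ## §3 Bridges to the program's blocks -/

namespace BlockGauge

variable {σ : Type*} {k : Type*} [Field k] {n : Type*} [Fintype n] [DecidableEq n] (B : BlockGauge σ k n)

omit [Fintype n] in
/-- The program's step block is `stepRaw`. -/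
theorem stepBlk_eq_raw (p : ℕ) : B.stepBlk p = stepRaw B.Z (C ((p + 1 : k)⁻¹)) := rfl

omit [Fintype n] in
/-- The program's collecting block is `collectRaw`. -/
theorem collectBlk_eq_raw (d : ℕ) : B.collectBlk d = collectRaw B.Z B.c (C ((d + 1 : k)⁻¹)) := rfl

omit [Fintype n] [DecidableEq n] in
/-- The program's closing block is `sinkRaw`. -/
theorem sinkBlk_eq_raw : B.sinkBlk = sinkRaw B.r B.ℓ := rfl

end BlockGauge

end

end Summit.ValiantsHypothesis.ValiantsHypothesis.Theorems.EquivariantDialLayers
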